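import Summits.CriticalPhenomena.SAWScalingLimit.Theses.SAWLeftRightFKG
import HarnessLib

/-!
# Negative knowledge on crux `NotFKGAtOne` (stmt-CriticalPhenomena-11233), part 1: where a witness cannot be

`NotFKGAtOne` (route SAWLeftRightFKG) is the EXISTENTIAL finite certificate "for some lattice domain `(C, a, b)` and
some pair of `≼`-up-closed chord events `A, B`, `|A|·|B| > |U|·|A ∩ B|` (counting measure)".  It is TRUE (crux
workfile `Cruxes/NotFKGAtOne/Disproof.lean`: a 7-chord witness on 8 vertices, a 12-chord witness on the 3 × 3 box,
none below 8 vertices).  This file records, sorry-free, the constraints every witness must meet — the part of the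
disprover's analysis that is measure-blind:

* nested events never witness, for ANY measure (`measure_fkg_of_subset`, `measure_fkg_of_superset`); hence a
  witness needs two `≼`-INCOMPARABLE chords (`notFKGAtOne_body_of_total`);
* degenerate data never witness: `a = b` or `a ∉ Ω_δ` give a subsingleton chord space
  (`notFKGAtOne_body_of_eq`, `notFKGAtOne_body_of_not_mem_meshDomain`);
* Daykin's inequality: in a finite DISTRIBUTIVE lattice the counting measure satisfies the event inequality for all
  up-sets (`card_fkg_of_distribLattice`) — the witness lives on the non-distributivity of the `ℤ²` chord poset;
(The certificate itself — the `3 × 3` box — is parts 2–3: `Box3Domain.lean`, `Box3Witness.lean`.)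
[folklore]
-/

namespace Summit.CriticalPhenomena.SAWScalingLimit.Theorems.NotFKGAtOne.Negative

open scoped ENNReal FinsetFamily
open MeasureTheory Set Literature.Probability.LatticeModels Literature.Probability.RandomPlanarGeometry
  Literature.Topology.PlaneTopology

/-! ## Measure-blind facts -/

/-- Nested events satisfy the FKG event inequality for every measure (`A ⊆ B`). [folklore] -/
theorem measure_fkg_of_subset {α : Type*} [MeasurableSpace α] (μ : Measure α) {A B : Set α}
    (h : A ⊆ B) : μ A * μ B ≤ μ univ * μ (A ∩ B) := by
  rw [inter_eq_left.2 h, mul_comm]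
  exact mul_le_mul' (measure_mono (subset_univ B)) le_rfl

/-- Nested events satisfy the FKG event inequality for every measure (`B ⊆ A`). [folklore] -/
theorem measure_fkg_of_superset {α : Type*} [MeasurableSpace α] (μ : Measure α) {A B : Set α}
    (h : B ⊆ A) : μ A * μ B ≤ μ univ * μ (A ∩ B) := by
  rw [inter_eq_right.2 h]
  exact mul_le_mul' (measure_mono (subset_univ A)) le_rfl

/-- Up-sets of a total relation are nested. [folklore] -/
theorem nested_of_total {α : Type*} {r : α → α → Prop} (htot : ∀ x y, r x y ∨ r y x) {A B : Set α}
    (hA : ∀ x y, r x y → x ∈ A → y ∈ A) (hB : ∀ x y, r x y → x ∈ B → y ∈ B) : A ⊆ B ∨ B ⊆ A := by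
  by_contra h
  obtain ⟨hAB, hBA⟩ := not_or.1 h
  obtain ⟨x, hxA, hxB⟩ := not_subset.1 hAB
  obtain ⟨y, hyB, hyA⟩ := not_subset.1 hBA
  rcases htot x y with hxy | hyx
  · exact hyA (hA x y hxy hxA)
  · exact hxB (hB y x hyx hyB)

/-- For a total relation the FKG event inequality holds for every measure and all up-sets. [folklore] -/
theorem measure_fkg_of_total {α : Type*} [MeasurableSpace α] (μ : Measure α) {r : α → α → Prop}
    (htot : ∀ x y, r x y ∨ r y x) {A B : Set α} (hA : ∀ x y, r x y → x ∈ A → y ∈ A)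
    (hB : ∀ x y, r x y → x ∈ B → y ∈ B) : μ A * μ B ≤ μ univ * μ (A ∩ B) := by
  rcases nested_of_total htot hA hB with h | h
  exacts [measure_fkg_of_subset μ h, measure_fkg_of_superset μ h]

/-- In a subsingleton type any two sets are nested. [folklore] -/
theorem nested_of_subsingleton {α : Type*} [Subsingleton α] (A B : Set α) : A ⊆ B ∨ B ⊆ A := by
  by_cases h : A ⊆ B
  · exact Or.inl h
  · right
    obtain ⟨x, -, hxB⟩ := not_subset.1 h
    intro y hy
    rw [Subsingleton.elim y x] at hy
    exact (hxB hy).elim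

/-- On a subsingleton type the FKG event inequality holds for every measure and all events. [folklore] -/
theorem measure_fkg_of_subsingleton {α : Type*} [MeasurableSpace α] [Subsingleton α] (μ : Measure α)
    (A B : Set α) : μ A * μ B ≤ μ univ * μ (A ∩ B) := by
  rcases nested_of_subsingleton A B with h | h
  exacts [measure_fkg_of_subset μ h, measure_fkg_of_superset μ h]

/-- **Daykin ⇒ event FKG for the counting measure on a finite distributive lattice**:
`|A||B| ≤ |A ⊼ B||A ⊻ B| ≤ |U||A ∩ B|` for up-sets `A, B` (`Finset.le_card_infs_mul_card_sups`).  So the chord poset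
of a witness of `NotFKGAtOne` is not (order-isomorphic to) a distributive lattice. [folklore] -/
theorem card_fkg_of_distribLattice {α : Type*} [DistribLattice α] [Fintype α] [DecidableEq α]
    (A B : Finset α) (hA : IsUpperSet (A : Set α)) (hB : IsUpperSet (B : Set α)) :
    A.card * B.card ≤ Fintype.card α * (A ∩ B).card := by
  have hsub : A ⊻ B ⊆ A ∩ B := by
    intro x hx
    rw [Finset.mem_sups] at hx
    obtain ⟨a, ha, b, hb, rfl⟩ := hx
    exact Finset.mem_inter.2 ⟨hA le_sup_left ha, hB le_sup_right hb⟩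
  calc A.card * B.card ≤ (A ⊼ B).card * (A ⊻ B).card := Finset.le_card_infs_mul_card_sups A B
    _ ≤ Fintype.card α * (A ∩ B).card :=
        Nat.mul_le_mul (Finset.card_le_univ _) (Finset.card_le_card hsub)

/-! ## Degenerate chord spaces -/

/-- The chords from `a` to `a` reduce to the trivial one. [folklore] -/
theorem subsingleton_domainSAW_self (Ω : Set ℂ) (δ : ℝ) (a : Site 2) :
    Subsingleton (SAW.DomainSAW Ω δ a a) := by
  refine ⟨fun γ₁ γ₂ => ?_⟩
  obtain ⟨w₁, h₁⟩ := γ₁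
  obtain ⟨w₂, h₂⟩ := γ₂
  have e₁ : w₁ = SimpleGraph.Walk.nil :=
    SimpleGraph.Walk.eq_nil_iff_nil.2 (SimpleGraph.Walk.isPath_iff_nil.1 h₁)
  have e₂ : w₂ = SimpleGraph.Walk.nil :=
    SimpleGraph.Walk.eq_nil_iff_nil.2 (SimpleGraph.Walk.isPath_iff_nil.1 h₂)
  subst e₁ e₂
  rfl

/-- If `a ≠ b` and `a` is not a vertex of `Ω_δ` there is no chord from `a` to `b`. [folklore] -/
theorem isEmpty_domainSAW_of_not_mem {Ω : Set ℂ} {δ : ℝ} {a b : Site 2} (hab : a ≠ b)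
    (ha : a ∉ meshDomain Ω δ) : IsEmpty (SAW.DomainSAW Ω δ a b) := by
  refine ⟨fun γ => ?_⟩
  obtain ⟨w, -⟩ := γ
  cases w with
  | nil => exact hab rfl
  | cons h _ => exact ha (discreteDomainGraph_adj_iff.1 h).2.1

/-- If `a` is not a vertex of `Ω_δ` the chord space from `a` is a subsingleton. [folklore] -/
theorem subsingleton_domainSAW_of_not_mem {Ω : Set ℂ} {δ : ℝ} {a : Site 2} (b : Site 2)
    (ha : a ∉ meshDomain Ω δ) : Subsingleton (SAW.DomainSAW Ω δ a b) := by
  by_cases hab : a = b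
  · subst hab
    exact subsingleton_domainSAW_self Ω δ a
  · haveI := isEmpty_domainSAW_of_not_mem hab ha
    infer_instance

/-! ## Consequences for the crux body (verbatim `let Ω`, `let le` of `NotFKGAtOne`) -/

/-- **A witness of `NotFKGAtOne` needs two `≼`-incomparable chords**: if the left–right relation is total on the
chords of `(C, a, b)` then the ∀-body of the crux holds there (for every measure, here `Measure.count`). [folklore] -/
theorem notFKGAtOne_body_of_total (δ : ℝ) (c a b a' b' : Site 2) (C : (zdGraph 2).Walk c c) :
    let Ω : Set ℂ := {z | wind (fun t : ℝ => Set.IccExtend zero_le_one (C.toCurve (meshPoint δ)) t - z) ≠ 0}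
    let le : SAW.DomainSAW Ω δ a b → SAW.DomainSAW Ω δ a b → Prop := fun γ₁ γ₂ => ∀ z : ℂ,
      0 ≤ wind (fun t : ℝ =>
        Set.IccExtend zero_le_one ((γ₁.walk.append γ₂.walk.reverse).toCurve (meshPoint δ)) t - z)
    (∀ γ₁ γ₂, le γ₁ γ₂ ∨ le γ₂ γ₁) →
    0 < δ → a' ∈ C.support → b' ∈ C.support → (zdGraph 2).Adj a a' → (zdGraph 2).Adj b b' →
    ∀ A B : Set (SAW.DomainSAW Ω δ a b), (∀ γ₁ γ₂, le γ₁ γ₂ → γ₁ ∈ A → γ₂ ∈ A) →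
      (∀ γ₁ γ₂, le γ₁ γ₂ → γ₁ ∈ B → γ₂ ∈ B) →
      Measure.count A * Measure.count B ≤
        Measure.count (Set.univ : Set (SAW.DomainSAW Ω δ a b)) * Measure.count (A ∩ B) := by
  intro Ω le htot _ _ _ _ _ A B hA hB
  exact measure_fkg_of_total Measure.count htot hA hB

/-- **Degenerate data never witness (i)**: a subsingleton chord space (in particular `a = b`, or `a ∉ Ω_δ` —
e.g. `a` on the trace of `C` or outside it) satisfies the ∀-body of the crux. [folklore] -/
theorem notFKGAtOne_body_of_subsingleton (δ : ℝ) (c a b a' b' : Site 2) (C : (zdGraph 2).Walk c c) :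
    let Ω : Set ℂ := {z | wind (fun t : ℝ => Set.IccExtend zero_le_one (C.toCurve (meshPoint δ)) t - z) ≠ 0}
    let le : SAW.DomainSAW Ω δ a b → SAW.DomainSAW Ω δ a b → Prop := fun γ₁ γ₂ => ∀ z : ℂ,
      0 ≤ wind (fun t : ℝ =>
        Set.IccExtend zero_le_one ((γ₁.walk.append γ₂.walk.reverse).toCurve (meshPoint δ)) t - z)
    Subsingleton (SAW.DomainSAW Ω δ a b) →
    0 < δ → a' ∈ C.support → b' ∈ C.support → (zdGraph 2).Adj a a' → (zdGraph 2).Adj b b' →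
    ∀ A B : Set (SAW.DomainSAW Ω δ a b), (∀ γ₁ γ₂, le γ₁ γ₂ → γ₁ ∈ A → γ₂ ∈ A) →
      (∀ γ₁ γ₂, le γ₁ γ₂ → γ₁ ∈ B → γ₂ ∈ B) →
      Measure.count A * Measure.count B ≤
        Measure.count (Set.univ : Set (SAW.DomainSAW Ω δ a b)) * Measure.count (A ∩ B) := by
  intro Ω le hs _ _ _ _ _ A B _ _
  exact measure_fkg_of_subsingleton Measure.count A B

/-- **Degenerate data never witness (ii)**: coincident endpoints `a = b`. [folklore] -/
theorem notFKGAtOne_body_of_eq (δ : ℝ) (c a a' b' : Site 2) (C : (zdGraph 2).Walk c c) :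
    let Ω : Set ℂ := {z | wind (fun t : ℝ => Set.IccExtend zero_le_one (C.toCurve (meshPoint δ)) t - z) ≠ 0}
    let le : SAW.DomainSAW Ω δ a a → SAW.DomainSAW Ω δ a a → Prop := fun γ₁ γ₂ => ∀ z : ℂ,
      0 ≤ wind (fun t : ℝ =>
        Set.IccExtend zero_le_one ((γ₁.walk.append γ₂.walk.reverse).toCurve (meshPoint δ)) t - z)
    0 < δ → a' ∈ C.support → b' ∈ C.support → (zdGraph 2).Adj a a' → (zdGraph 2).Adj a b' →
    ∀ A B : Set (SAW.DomainSAW Ω δ a a), (∀ γ₁ γ₂, le γ₁ γ₂ → γ₁ ∈ A → γ₂ ∈ A) →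
      (∀ γ₁ γ₂, le γ₁ γ₂ → γ₁ ∈ B → γ₂ ∈ B) →
      Measure.count A * Measure.count B ≤
        Measure.count (Set.univ : Set (SAW.DomainSAW Ω δ a a)) * Measure.count (A ∩ B) := by
  intro Ω le _ _ _ _ _ A B _ _
  haveI := subsingleton_domainSAW_self Ω δ a
  exact measure_fkg_of_subsingleton Measure.count A B

/-- **Degenerate data never witness (iii)**: `a` not a vertex of the discrete domain `Ω_δ`. [folklore] -/
theorem notFKGAtOne_body_of_not_mem_meshDomain (δ : ℝ) (c a b a' b' : Site 2)
    (C : (zdGraph 2).Walk c c) :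
    let Ω : Set ℂ := {z | wind (fun t : ℝ => Set.IccExtend zero_le_one (C.toCurve (meshPoint δ)) t - z) ≠ 0}
    let le : SAW.DomainSAW Ω δ a b → SAW.DomainSAW Ω δ a b → Prop := fun γ₁ γ₂ => ∀ z : ℂ,
      0 ≤ wind (fun t : ℝ =>
        Set.IccExtend zero_le_one ((γ₁.walk.append γ₂.walk.reverse).toCurve (meshPoint δ)) t - z)
    a ∉ meshDomain Ω δ →
    0 < δ → a' ∈ C.support → b' ∈ C.support → (zdGraph 2).Adj a a' → (zdGraph 2).Adj b b' →
    ∀ A B : Set (SAW.DomainSAW Ω δ a b), (∀ γ₁ γ₂, le γ₁ γ₂ → γ₁ ∈ A → γ₂ ∈ A) →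
      (∀ γ₁ γ₂, le γ₁ γ₂ → γ₁ ∈ B → γ₂ ∈ B) →
      Measure.count A * Measure.count B ≤
        Measure.count (Set.univ : Set (SAW.DomainSAW Ω δ a b)) * Measure.count (A ∩ B) := by
  intro Ω le ha _ _ _ _ _ A B _ _
  haveI := subsingleton_domainSAW_of_not_mem (Ω := Ω) (δ := δ) b ha
  exact measure_fkg_of_subsingleton Measure.count A B

end Summit.CriticalPhenomena.SAWScalingLimit.Theorems.NotFKGAtOne.Negative
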